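import Literature.NumberTheory.EllipticCurves.MasserWustholzSurjectivity
import Literature.NumberTheory.EllipticCurves.RationalIsogenyDegreesProofs
import HarnessLib

/-!
# Masser–Wüstholz 1993, §3 ("Isogeny arguments"): Lemma 3.1 modulo the isogeny estimate

Topic `NumberTheory/EllipticCurves`; a proofs-only sibling (theorems only: no definitions, no
named facts) of `MasserWustholzSurjectivity` (the named fact
`Literature.NumberTheory.EllipticCurves.masserWustholz_surjective_modEll`, D. W. Masser,
G. Wüstholz, *Galois properties of division fields of elliptic curves*, Bull. London Math. Soc.
**25** (1993) 247–254, Theorem (b) at `k = ℚ`) and of `MasserWustholzSurjectivityProofs` (§4 of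
the paper, which reduces the Theorem over `ℚ` to effective forms of Lemmas 3.1–3.2:
`MasserWustholz1993.masserWustholz_surjective_modEll_of_effective_lemmas`).

Here is **Lemma 3.1** (p. 249), verbatim up to its transcendence input:

> LEMMA 3.1. Suppose `ℓ > c₁ M^{λ(1)}`. Then `φ_ℓ(G)` does not fix any one-dimensional subspace
> of `E_ℓ`.  *Proof.* … Suppose, to the contrary, that `φ_ℓ(G)` fixes some one-dimensional
> subspace `Γ` of `E_ℓ`. Then `Γ` is defined over `k`. So the abelian varieties `A = E` and
> `A* = E/Γ` are defined over `k` and isogenous over `k`. Hence by Lemma 2.2 (or Lemma 2.1) there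
> is an isogeny from `E/Γ` to `E` of degree `b ≤ c₁ M^{λ(1)}`. Composing this with the natural
> isogeny from `E` to `E/Γ` of degree `ℓ`, we end up with an endomorphism of `E`, which by
> hypothesis must be multiplication by some integer `p`. Comparing degrees, we obtain `p² = bℓ`.
> So `ℓ` divides `p`, and therefore `ℓ` must also divide `b`. In particular, `ℓ ≤ b`. This is a
> contradiction, and the lemma is proved.

The only input not proved in the tree is Lemma 2.2 at `n = 1` (Masser–Wüstholz, Ann. of Math.
137 (1993), §6: an isogeny `E/Γ → E` over `k` of degree `≤ C (max{d, h(E)})^λ`; transcendence).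
It enters below as the hypothesis `hB` — a bound `B` for the degree of some isogeny `E' → E` from
every curve `E'` isogenous to `E` over `K` — and, in the `ℚ`-assembly, as the hypothesis `hL22`
(the same with `B = c · max(1, h_F(E))^γ`).  Everything else is the tree's: the quotient
`g : E → E/Γ` over `K` with `ker g = Γ` (`WeierstrassCurve.exists_isogeny_ker_eq_and_comp_eq_nsmul_holds`,
Silverman *AEC* III.4.12), composition of isogenies (`Isogeny.comp`), surjectivity on `K̄`-points
(`Isogeny.surjective`, *AEC* II.2.3), `#ker(ψ ∘ g) = #ker ψ · #ker g`
(`AddMonoidHom.natCard_ker_comp_of_surjective`), `#E[n] = n²`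
(`WeierstrassCurve.natCard_geomTorsion_int_eq_sq`, *AEC* III.6.4), and the dictionary "reducible
`E[ℓ]` ⟺ a stable subgroup of order `ℓ`"
(`Mazur1978.not_hasIrreducibleModPGaloisRep_iff_exists_natCard_eq`).  "No complex
multiplication over `k̄`" is `¬ W.HasCM` (`End_{K̄}(E) = ℤ`), which contains `End_K(E) = ℤ`.

* `MasserWustholz1993.exists_comp_eq_zsmul` — for non-CM `E`, `ψ ∘ g = [n]` for isogenies
  `g : E → E'`, `ψ : E' → E` over `K`.
* `MasserWustholz1993.degree_mul_degree_eq_sq` — "comparing degrees": `deg ψ · deg g = n²`,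
  `n ≠ 0` (characteristic `0`).
* `MasserWustholz1993.degree_dvd_degree_of_prime` — `deg g = ℓ` prime ⇒ `ℓ ∣ deg ψ`.
* `MasserWustholz1993.hasIrreducibleModPGaloisRep_of_forall_isogeny_degree_le` — **Lemma 3.1
  modulo Lemma 2.2**: if every `E'` isogenous to `E` over `K` maps back to `E` by an isogeny of
  degree `≤ B`, then `E[ℓ]` is irreducible for every prime `ℓ > B` (any field of
  characteristic `0`).
* `MasserWustholz1993.effectiveLemma31_of_isogenyEstimate` — over `ℚ`: the Faltings-height form
  of Lemma 2.2 at `n = 1` yields hypothesis `h31` of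
  `masserWustholz_surjective_modEll_of_effective_lemmas` with the same `c, γ` ((4.1)).

## References

* [MasserWustholzBLMS1993] D. W. Masser, G. Wüstholz, Bull. London Math. Soc. 25 (1993)
  247–254: §2 Lemma 2.2 (pp. 248–249), §3 Lemma 3.1 (p. 249), §4 (4.1) (p. 250).
* [SilvermanAEC2009] J. H. Silverman, *The Arithmetic of Elliptic Curves*, 2nd ed.: II.2.3,
  III.4.12, III.6.4(b).
-/

noncomputable section

open scoped Classical

universe u

namespace Literature.NumberTheory.EllipticCurves

namespace MasserWustholz1993

open _root_.WeierstrassCurve Field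

section Degrees

variable {K : Type u} [Field K] {W W' : WeierstrassCurve K} [W.IsElliptic] [W'.IsElliptic]

omit [W.IsElliptic] [W'.IsElliptic] in
/-- **"An endomorphism of `E`, which by hypothesis must be multiplication by some integer"**: if
`E` has no complex multiplication over `K̄` (`End_{K̄}(E) = ℤ`), then for isogenies `g : E → E'`,
`ψ : E' → E` over `K` the composite `ψ ∘ g ∈ End_K(E) ⊆ End_{K̄}(E)` is `[n]` for some `n ∈ ℤ`.
[cite: MasserWustholzBLMS1993, §3, proof of Lemma 3.1 (p. 249)] -/
theorem exists_comp_eq_zsmul (hW : ¬ W.HasCM) (g : Isogeny W W') (ψ : Isogeny W' W) :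
    ∃ n : ℤ, ∀ P, ψ (g P) = n • P := by
  have hmem : ((ψ.comp g).toAddMonoidHom : AddMonoid.End W.geomPoints) ∈ W.geomEndRing :=
    W.endRing_le_geomEndRing (ψ.comp g).toAddMonoidHom_mem_endRing
  by_contra hne
  push Not at hne
  refine hW ⟨_, hmem, fun n hn ↦ ?_⟩
  obtain ⟨P, hP⟩ := hne n
  apply hP
  have := DFunLike.congr_fun hn P
  rw [AddMonoid.End.intCast_apply] at this
  exact this

/-- **"Comparing degrees, we obtain `p² = bℓ`"**: for non-CM `E` in characteristic `0` and
isogenies `g : E → E'`, `ψ : E' → E` over `K`, `deg ψ · deg g = n²` with `n ≠ 0` — the composite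
`ψ ∘ g = [n]` has kernel `E[n]` of order `n²` (*AEC* III.6.4(b)), and `#ker(ψ ∘ g) = #ker ψ · #ker g`
because `g` is onto `E'(K̄)` (*AEC* II.2.3); `n ≠ 0` as the kernel is finite and `E(K̄)` is not.
[cite: MasserWustholzBLMS1993, §3, proof of Lemma 3.1 (p. 249)] -/
theorem degree_mul_degree_eq_sq [CharZero K] (hW : ¬ W.HasCM) (g : Isogeny W W')
    (ψ : Isogeny W' W) : ∃ n : ℕ, n ≠ 0 ∧ ψ.degree * g.degree = n ^ 2 := by
  obtain ⟨n, hn⟩ := exists_comp_eq_zsmul hW g ψ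
  have h1 : Nat.card (ψ.comp g).toAddMonoidHom.ker = ψ.degree * g.degree :=
    AddMonoidHom.natCard_ker_comp_of_surjective ψ.toAddMonoidHom g.toAddMonoidHom g.surjective
  have hn0 : n ≠ 0 := by
    rintro rfl
    have hker0 : (ψ.comp g).toAddMonoidHom.ker = ⊤ := by
      ext P
      simp only [AddMonoidHom.mem_ker, Isogeny.coe_toAddMonoidHom, Isogeny.comp_apply, hn,
        zero_smul, AddSubgroup.mem_top]
    have := h1
    rw [hker0, AddSubgroup.card_top, Nat.card_eq_zero_of_infinite] at this
    exact (mul_pos ψ.degree_pos g.degree_pos).ne' this.symm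
  have hχker : (ψ.comp g).toAddMonoidHom.ker = geomTorsion W n := by
    ext P
    rw [AddMonoidHom.mem_ker, Isogeny.coe_toAddMonoidHom, Isogeny.comp_apply, hn]
    rfl
  refine ⟨n.natAbs, Int.natAbs_ne_zero.mpr hn0, ?_⟩
  rw [← h1, hχker, natCard_geomTorsion_int_eq_sq W hn0]

/-- **"So `ℓ` divides `p`, and therefore `ℓ` must also divide `b`"**: for non-CM `E` in
characteristic `0`, if `g : E → E'` has prime degree `ℓ` then `ℓ` divides the degree of every
isogeny `ψ : E' → E` over `K` (`bℓ = p²` forces `ℓ ∣ p`, `ℓ² ∣ bℓ`).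
[cite: MasserWustholzBLMS1993, §3, proof of Lemma 3.1 (p. 249)] -/
theorem degree_dvd_degree_of_prime [CharZero K] (hW : ¬ W.HasCM) (g : Isogeny W W')
    (ψ : Isogeny W' W) (hℓ : g.degree.Prime) : g.degree ∣ ψ.degree := by
  obtain ⟨n, -, hsq⟩ := degree_mul_degree_eq_sq hW g ψ
  have h1 : g.degree ∣ n ^ 2 := ⟨ψ.degree, by rw [← hsq, mul_comm]⟩
  obtain ⟨m, hm⟩ := hℓ.dvd_of_dvd_pow h1
  refine ⟨m ^ 2, Nat.eq_of_mul_eq_mul_right hℓ.pos ?_⟩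
  rw [hsq, hm]
  ring

end Degrees

section Lemma31

variable {K : Type u} [Field K] [CharZero K] (W : WeierstrassCurve K) [W.IsElliptic]

/-- **Masser–Wüstholz 1993, Lemma 3.1, modulo the isogeny estimate (Lemma 2.2 at `n = 1`).**
Let `E = W` be an elliptic curve over a field `K` of characteristic `0` without complex
multiplication over `K̄`, and suppose that every elliptic curve `E'` isogenous to `E` over `K`
admits an isogeny `E' → E` over `K` of degree `≤ B` (for a number field `K` of degree `d` this is
Lemma 2.2 with `B = c₁ (max{d, h(E)})^{λ(1)}`).  Then for every prime `ℓ > B` the Galois module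
`E[ℓ]` is irreducible: `φ_ℓ(G)` fixes no line.  Proof as printed: a `Γ_K`-stable line `Γ ⊂ E[ℓ]`
is a stable subgroup of order `ℓ`, the kernel of the quotient `g : E → E/Γ` over `K` (*AEC*
III.4.12, Rem. III.4.13.2, the tree's `exists_isogeny_ker_eq_and_comp_eq_nsmul_holds`), the
hypothesis gives `ψ : E/Γ → E` of degree `b ≤ B`, and `ℓ ∣ b` (`degree_dvd_degree_of_prime`),
so `ℓ ≤ b ≤ B`, a contradiction. [cite: MasserWustholzBLMS1993, §3 Lemma 3.1 (p. 249)] -/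
theorem hasIrreducibleModPGaloisRep_of_forall_isogeny_degree_le (hW : ¬ W.HasCM) {B : ℕ}
    (hB : ∀ (W' : WeierstrassCurve K) [W'.IsElliptic], IsIsogenous W W' →
      ∃ ψ : Isogeny W' W, ψ.degree ≤ B)
    {ℓ : ℕ} (hℓ : ℓ.Prime) (hBℓ : B < ℓ) : W.HasIrreducibleModPGaloisRep ℓ := by
  haveI : Fact ℓ.Prime := ⟨hℓ⟩
  haveI : NeZero (ℓ : K) := ⟨Nat.cast_ne_zero.mpr hℓ.ne_zero⟩
  by_contra hred
  obtain ⟨H, hHstab, hHcard⟩ :=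
    (Mazur1978.not_hasIrreducibleModPGaloisRep_iff_exists_natCard_eq W ℓ).mp hred
  -- the stable line `Γ` as a finite `Γ_K`-stable subgroup `S ≤ E(K̄)` of order `ℓ`
  set S : AddSubgroup W.geomPoints := H.map (geomTorsion W (ℓ : ℤ)).subtype with hS
  have hScard : Nat.card S = ℓ := by
    rw [← hHcard]
    exact Nat.card_congr (H.equivMapOfInjective _ (geomTorsion W (ℓ : ℤ)).subtype_injective).symm
  have hSfin : (S : Set W.geomPoints).Finite :=
    Nat.finite_of_card_ne_zero (hScard ▸ hℓ.ne_zero)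
  have hSstab : ∀ (σ : absoluteGaloisGroup K) (P : W.geomPoints), P ∈ S → σ • P ∈ S := by
    rintro σ P ⟨Q, hQ, rfl⟩
    exact ⟨σ • Q, hHstab σ Q hQ, rfl⟩
  -- the quotient `g : E → E' = E/Γ` over `K`, of degree `ℓ`
  obtain ⟨W', hW', g, -, hker, -, -⟩ :=
    W.exists_isogeny_ker_eq_and_comp_eq_nsmul_holds S hSfin hSstab
  haveI := hW'
  have hg : g.degree = ℓ := by
    change Nat.card g.toAddMonoidHom.ker = ℓ
    rw [hker, hScard]
  -- the isogeny estimate: `ψ : E' → E` of degree `b ≤ B`; but `ℓ ∣ b`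
  obtain ⟨ψ, hψ⟩ := hB W' ⟨g⟩
  have hprime : g.degree.Prime := by rw [hg]; exact hℓ
  have hdvd : g.degree ∣ ψ.degree := degree_dvd_degree_of_prime hW g ψ hprime
  rw [hg] at hdvd
  exact absurd ((Nat.le_of_dvd ψ.degree_pos hdvd).trans hψ) (not_le.mpr hBℓ)

end Lemma31

/-! ### Over `ℚ`: hypothesis `h31` of the §4 assembly from Lemma 2.2 at `n = 1` -/

section Rat

/-- **(4.1) over `ℚ`: the effective Lemma 3.1 from the effective isogeny estimate.**  If there
are absolute `c, γ ≥ 0` such that for every non-CM elliptic curve `E/ℚ` and every `E'` isogenous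
to `E` over `ℚ` there is an isogeny `E' → E` over `ℚ` of degree `≤ c · max(1, h_F(E))^γ`
(Lemma 2.2 at `n = 1`, `d = 1`, in the Faltings-height form of §2), then for every non-CM `E/ℚ`
and every prime `ℓ > c · max(1, h_F(E))^γ` the module `E[ℓ]` is irreducible — hypothesis `h31`
of `MasserWustholz1993.masserWustholz_surjective_modEll_of_effective_lemmas`, with the same
constants. [cite: MasserWustholzBLMS1993, §3 Lemma 3.1 and §4 (4.1) (pp. 249–250)] -/
theorem effectiveLemma31_of_isogenyEstimate
    (hL22 : ∃ (c γ : ℝ), 0 ≤ γ ∧ ∀ (W : WeierstrassCurve ℚ) [W.IsElliptic], ¬ W.HasCM →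
      ∀ (W' : WeierstrassCurve ℚ) [W'.IsElliptic], IsIsogenous W W' →
        ∃ ψ : Isogeny W' W, (ψ.degree : ℝ) ≤ c * (max 1 W.stableFaltingsHeight) ^ γ) :
    ∃ (c γ : ℝ), 0 ≤ γ ∧ ∀ (W : WeierstrassCurve ℚ) [W.IsElliptic], ¬ W.HasCM →
      ∀ ℓ : ℕ, ℓ.Prime → c * (max 1 W.stableFaltingsHeight) ^ γ < ℓ →
        W.HasIrreducibleModPGaloisRep ℓ := by
  obtain ⟨c, γ, hγ, h⟩ := hL22
  refine ⟨c, γ, hγ, fun W _ hW ℓ hℓ hlt ↦ ?_⟩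
  set T : ℝ := c * (max 1 W.stableFaltingsHeight) ^ γ with hT
  refine hasIrreducibleModPGaloisRep_of_forall_isogeny_degree_le W hW (B := ⌊T⌋₊)
    (fun W' _ hWW' ↦ ?_) hℓ ((Nat.floor_lt' hℓ.ne_zero).mpr hlt)
  obtain ⟨ψ, hψ⟩ := h W hW W' hWW'
  exact ⟨ψ, Nat.le_floor hψ⟩

end Rat

end MasserWustholz1993

end Literature.NumberTheory.EllipticCurves

end
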